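import Literature.MathematicalPhysics.QuantumLattice.PairCorrelationsProofs
import Literature.MathematicalPhysics.QuantumLattice.HubbardWave0LiebProofs
import HarnessLib

/-!
# Route EnslavedA1g — torus bookkeeping: neighbours of a site and normal forms of the pair fields

Helper file of route `EnslavedA1g` (supports item `stmt-HubbardSuperconductivity-0935`,
`Summit.HubbardSuperconductivity.HubbardSuperconductivity.Theses.EnslavedA1g.A1gSlavingTransfer`; also used
by the proof of `EnslavedA1gIdentity`, item `stmt-HubbardSuperconductivity-0936`). Pure bookkeeping on the
fermionic torus `(ℤ/Lℤ)²` of the prelude (`TorusSite`, `torusGraph`, `FermionTorus`, `fermionTorusGraph`,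
`unitSteps`, `localPair`, `pairField`, `hubbardTorus` are all REUSED; no definition is introduced):

* `torusGraph_adj_iff_unitSteps`, `sum_ite_adj_eq_sum_unitSteps`, `sum_ite_fermionAdj_eq_sum_unitSteps`:
  for `L ≥ 3` the neighbours of a torus site `y` are exactly the four DISTINCT sites `y + e`,
  `e ∈ unitSteps = {±e₁, ±e₂}` (for `L ≤ 2` they coincide in pairs — the reason for the guard `2 < L` in
  `EnslavedA1gIdentity`), so adjacency sums become sums over the unit steps;
* `pairField_sWave`: `pairField sWave L = √2 Σ_x c_{x↑} c_{x↓}` (every `L ≥ 1`);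
* `pairField_extendedSWave`: `pairField extendedSWave L = √2 Σ_x Σ_{e ∈ unitSteps} c_{x↑} c_{x+e,↓}`
  (every `L ≥ 1`; the `↓↑` half of `localPair` is the `↑↓` half after `x ↦ x + e`, `e ↦ -e` and one
  anticommutation);
* `hubbardTorus_eq_sum_unitSteps`: for `L ≥ 3`,
  `hubbardTorus 2 L t U = -t Σ_x Σ_{e ∈ unitSteps} Σ_σ c†_{xσ} c_{x+e,σ} + U Σ_x n_{x↑} n_{x↓}`.

Sources: S. Friedli, Y. Velenik, *Statistical Mechanics of Lattice Systems* (2017) §3.1 (tori);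
D. J. Scalapino, Phys. Rep. 250 (1995) 329, §2 (pair fields); E. H. Lieb, PRL 62 (1989) 1201 (the model).
All statements are folklore bookkeeping.
-/

noncomputable section

namespace Summit.HubbardSuperconductivity.EnslavedA1g

open Matrix Finset Literature.MathematicalPhysics.QuantumLattice Literature.Probability.LatticeModels
open scoped ComplexOrder

/-! ### Torus geometry: the four neighbours of a site for `L ≥ 3` -/

section TorusGeometry

variable {L : ℕ}

/-- `Torus.proj` of a unit coordinate vector is the unit coordinate vector of the torus. [folklore] -/
theorem torusProj_single (L : ℕ) (i : Fin 2) :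
    Torus.proj (d := 2) L (Pi.single i 1) = Pi.single i 1 := by
  funext j
  by_cases h : j = i
  · subst h; simp [Torus.proj]
  · simp [Torus.proj, h]

/-- `Torus.proj L 0 = 0`. [folklore] -/
theorem torusProj_zero (L : ℕ) : Torus.proj (d := 2) L 0 = 0 := by
  funext j; simp [Torus.proj]

/-- `1 ≠ 0` in `ℤ/Lℤ` for `L ≥ 3`. [folklore] -/
theorem one_ne_zero_zmod (hL : 2 < L) : (1 : ZMod L) ≠ 0 := by
  haveI : Fact (1 < L) := ⟨by omega⟩
  exact one_ne_zero

/-- `1 ≠ -1` in `ℤ/Lℤ` for `L ≥ 3`. [folklore] -/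
theorem one_ne_neg_one_zmod (hL : 2 < L) : (1 : ZMod L) ≠ -1 := by
  haveI : Fact (2 < L) := ⟨hL⟩
  exact fun h => ZMod.neg_one_ne_one h.symm

/-- For `L ≥ 3`, adjacency on the discrete torus `(ℤ/Lℤ)²` means `z = y + e` for one of the four
unit steps `e ∈ {±e₁, ±e₂}`. Friedli–Velenik (2017) §3.1. [folklore] -/
theorem torusGraph_adj_iff_unitSteps (hL : 2 < L) (y z : TorusSite 2 L) :
    (torusGraph 2 L).Adj y z ↔ ∃ e ∈ unitSteps, z = y + Torus.proj L e := by
  rw [torusGraph_adj_iff]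
  constructor
  · rintro ⟨-, ⟨i, rfl⟩ | ⟨i, rfl⟩⟩
    · refine ⟨Pi.single i 1, ?_, by rw [torusProj_single]⟩
      fin_cases i <;> simp [unitSteps]
    · refine ⟨-Pi.single i 1, ?_, ?_⟩
      · fin_cases i <;> simp [unitSteps]
      · rw [Torus.proj_neg, torusProj_single, add_neg_cancel_right]
  · rintro ⟨e, he, rfl⟩
    have h1 := one_ne_zero_zmod hL
    simp only [unitSteps, mem_insert, mem_singleton] at he
    have hne : Torus.proj (d := 2) L e ≠ 0 := by
      intro h0
      rcases he with rfl | rfl | rfl | rfl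
      · exact h1 (by simpa [torusProj_single] using congrFun h0 0)
      · exact h1 (by simpa [Torus.proj_neg, torusProj_single] using congrFun h0 0)
      · exact h1 (by simpa [torusProj_single] using congrFun h0 1)
      · exact h1 (by simpa [Torus.proj_neg, torusProj_single] using congrFun h0 1)
    refine ⟨fun h => hne (left_eq_add.mp h), ?_⟩
    rcases he with rfl | rfl | rfl | rfl
    · exact Or.inl ⟨0, by rw [torusProj_single]⟩
    · exact Or.inr ⟨0, by rw [Torus.proj_neg, torusProj_single, neg_add_cancel_right]⟩
    · exact Or.inl ⟨1, by rw [torusProj_single]⟩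
    · exact Or.inr ⟨1, by rw [Torus.proj_neg, torusProj_single, neg_add_cancel_right]⟩

/-- For `L ≥ 3` the four unit steps project to four DISTINCT torus vectors. [folklore] -/
theorem torusProj_injOn_unitSteps (hL : 2 < L) :
    Set.InjOn (Torus.proj (d := 2) L) unitSteps := by
  have h1 := one_ne_zero_zmod hL
  have h2 := one_ne_neg_one_zmod hL
  intro e₁ h₁ e₂ h₂ h
  have e0 := congrFun h 0
  have e1 := congrFun h 1
  simp only [coe_insert, coe_singleton, unitSteps, Set.mem_insert_iff, Set.mem_singleton_iff] at h₁ h₂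
  rcases h₁ with rfl | rfl | rfl | rfl <;> rcases h₂ with rfl | rfl | rfl | rfl <;>
    first
    | rfl
    | (exfalso; simp [Torus.proj] at e0 e1; first
        | exact h1 e0 | exact h1 e0.symm | exact h1 e1 | exact h1 e1.symm
        | exact h2 e0 | exact h2 e0.symm | exact h2 e1 | exact h2 e1.symm)

/-- **Neighbour sums on the torus, `L ≥ 3`.** A sum over the torus sites adjacent to `y` is the sum over
the four unit steps `e` of the value at `y + e`. Friedli–Velenik (2017) §3.1. [folklore] -/
theorem sum_ite_adj_eq_sum_unitSteps {M : Type*} [AddCommMonoid M] [NeZero L] (hL : 2 < L)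
    (y : TorusSite 2 L) (f : TorusSite 2 L → M) :
    ∑ z, (if (torusGraph 2 L).Adj y z then f z else 0) =
      ∑ e ∈ unitSteps, f (y + Torus.proj L e) := by
  classical
  rw [← Finset.sum_filter]
  have hinj : Set.InjOn (fun e : Site 2 => y + Torus.proj L e) unitSteps :=
    fun e₁ h₁ e₂ h₂ h => torusProj_injOn_unitSteps hL h₁ h₂ (add_left_cancel h)
  rw [← Finset.sum_image hinj]
  refine Finset.sum_congr ?_ fun _ _ => rfl
  ext z
  simp only [mem_filter, mem_univ, true_and, mem_image, torusGraph_adj_iff_unitSteps hL]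
  constructor
  · rintro ⟨e, he, rfl⟩; exact ⟨e, he, rfl⟩
  · rintro ⟨e, he, rfl⟩; exact ⟨e, he, rfl⟩

/-- Neighbour sums on the fermionic torus (`FermionTorus 2 L`, adjacency pulled back from
`torusGraph`), `L ≥ 3`: the sum over the neighbours of `y` is the sum over the four unit steps.
Friedli–Velenik (2017) §3.1. [folklore] -/
theorem sum_ite_fermionAdj_eq_sum_unitSteps {M : Type*} [AddCommMonoid M] [NeZero L] (hL : 2 < L)
    (y : FermionTorus 2 L) (F : FermionTorus 2 L → M) :
    ∑ z, (if (fermionTorusGraph 2 L).Adj y z then F z else 0) =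
      ∑ e ∈ unitSteps, F (FermionTorus.ofTorusSite (y.toTorusSite + Torus.proj L e)) := by
  rw [← (FermionTorus.equivTorusSite (d := 2) (L := L)).symm.sum_comp]
  simp only [fermionTorusGraph_adj]
  have h : ∀ x : TorusSite 2 L,
      ((FermionTorus.equivTorusSite (d := 2) (L := L)).symm x) = FermionTorus.ofTorusSite x :=
    fun _ => rfl
  simp only [h, FermionTorus.toTorusSite_ofTorusSite]
  exact sum_ite_adj_eq_sum_unitSteps hL _ _

/-- The torus `(ℤ/Lℤ)²` has `L²` sites. [folklore] -/
theorem card_torusSite_two (L : ℕ) [NeZero L] : Fintype.card (TorusSite 2 L) = L ^ 2 := by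
  simp [Fintype.card_pi, ZMod.card]

/-- `0` is not a unit step. [folklore] -/
theorem zero_notMem_unitSteps : (0 : Site 2) ∉ unitSteps := by
  simp only [unitSteps, mem_insert, mem_singleton]
  decide

/-- The unit steps are symmetric under `e ↦ -e`: sums may be reindexed. [folklore] -/
theorem sum_unitSteps_neg {M : Type*} [AddCommMonoid M] (F : Site 2 → M) :
    ∑ e ∈ unitSteps, F (-e) = ∑ e ∈ unitSteps, F e := by
  refine Finset.sum_equiv (Equiv.neg (Site 2)) (fun i => ?_) (fun i _ => rfl)
  simp only [unitSteps, Finset.mem_insert, Finset.mem_singleton, Equiv.neg_apply,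
    neg_eq_iff_eq_neg, neg_neg]
  tauto

/-- There are four unit steps. [folklore] -/
theorem card_unitSteps : unitSteps.card = 4 := by
  decide

end TorusGeometry

/-! ### Normal forms of the pair fields and of the Hamiltonian, indexed by torus sites -/

section NormalForms

variable (L : ℕ) [NeZero L]

/-- `(1/√2) · 2 = √2` in `ℂ`. [folklore] -/
theorem inv_sqrt_two_mul_two : ((1 / Real.sqrt 2 : ℝ) : ℂ) * 2 = (Real.sqrt 2 : ℂ) := by
  have h : Real.sqrt 2 * Real.sqrt 2 = 2 := Real.mul_self_sqrt (by norm_num)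
  have h2 : (Real.sqrt 2 : ℝ) ≠ 0 := by positivity
  have : (1 / Real.sqrt 2 : ℝ) * 2 = Real.sqrt 2 := by
    field_simp
    linarith
  exact_mod_cast this

/-- **The on-site pair field.** `pairField sWave L = √2 Σ_x c_{x↑} c_{x↓}`: only the step `e = 0`
survives, and `c_{x↓} c_{x↑} = -c_{x↑} c_{x↓}`. Scalapino, Phys. Rep. 250 (1995) 329, §2. [folklore] -/
theorem pairField_sWave :
    pairField sWave L = ∑ x : TorusSite 2 L, (Real.sqrt 2 : ℂ) •
      (annihilation (orb (FermionTorus.ofTorusSite x) 0) *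
        annihilation (orb (FermionTorus.ofTorusSite x) 1)) := by
  unfold pairField localPair
  refine Finset.sum_congr rfl fun x _ => ?_
  rw [Finset.sum_eq_single_of_mem (0 : Site 2) (Finset.mem_insert_self _ _)]
  · have h0 : sWave 0 = 1 := if_pos rfl
    simp only [h0, torusProj_zero, add_zero]
    rw [LiebThm1.annihilation_mul_annihilation_eq_neg (orb (FermionTorus.ofTorusSite x) 1)
      (orb (FermionTorus.ofTorusSite x) 0), sub_neg_eq_add, ← two_smul ℂ, smul_smul,
      inv_sqrt_two_mul_two]
  · intro e _ hne
    have : sWave e = 0 := if_neg hne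
    simp [this]

/-- **The extended-`s` pair field.** `pairField extendedSWave L = √2 Σ_x Σ_{e ∈ {±e₁,±e₂}} c_{x↑} c_{x+e,↓}`
for every side `L ≥ 1`: the step `e = 0` does not contribute, and the second half
`-Σ_{x,e} c_{x↓} c_{x+e,↑} = Σ_{x,e} c_{x+e,↑} c_{x↓}` is the first after the reindexing
`x ↦ x + e`, `e ↦ -e`. Scalapino, Phys. Rep. 250 (1995) 329, §2. [folklore] -/
theorem pairField_extendedSWave :
    pairField extendedSWave L = ∑ x : TorusSite 2 L, ∑ e ∈ unitSteps, (Real.sqrt 2 : ℂ) •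
      (annihilation (orb (FermionTorus.ofTorusSite x) 0) *
        annihilation (orb (FermionTorus.ofTorusSite (x + Torus.proj L e)) 1)) := by
  -- abbreviations for the two halves
  set A : TorusSite 2 L → Site 2 → Matrix _ _ ℂ := fun x e =>
    annihilation (orb (FermionTorus.ofTorusSite x) 0) *
      annihilation (orb (FermionTorus.ofTorusSite (x + Torus.proj L e)) 1) with hA
  set B : TorusSite 2 L → Site 2 → Matrix _ _ ℂ := fun x e =>
    annihilation (orb (FermionTorus.ofTorusSite x) 1) *
      annihilation (orb (FermionTorus.ofTorusSite (x + Torus.proj L e)) 0) with hB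
  have hstep : pairField extendedSWave L =
      ∑ x : TorusSite 2 L, ∑ e ∈ unitSteps, ((1 / Real.sqrt 2 : ℝ) : ℂ) • (A x e - B x e) := by
    unfold pairField localPair
    refine Finset.sum_congr rfl fun x _ => ?_
    rw [Finset.sum_insert zero_notMem_unitSteps]
    have h0 : extendedSWave 0 = 0 := if_neg zero_notMem_unitSteps
    simp only [h0, zero_div, Complex.ofReal_zero, zero_smul, zero_add]
    refine Finset.sum_congr rfl fun e he => ?_
    have h1 : extendedSWave e = 1 := if_pos he
    rw [h1]
  -- the second half equals minus the first
  have hBA : ∑ x : TorusSite 2 L, ∑ e ∈ unitSteps, B x e =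
      -∑ x : TorusSite 2 L, ∑ e ∈ unitSteps, A x e := by
    rw [Finset.sum_comm]
    conv_rhs => rw [Finset.sum_comm, ← Finset.sum_neg_distrib, ← sum_unitSteps_neg]
    refine Finset.sum_congr rfl fun e _ => ?_
    rw [← Finset.sum_neg_distrib]
    refine Fintype.sum_equiv (Equiv.addRight (Torus.proj L e)) _ _ fun x => ?_
    simp only [hA, hB, Equiv.coe_addRight, Torus.proj_neg, add_neg_cancel_right]
    exact LiebThm1.annihilation_mul_annihilation_eq_neg _ _
  rw [hstep]
  simp only [smul_sub, Finset.sum_sub_distrib, ← Finset.smul_sum]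
  rw [hBA, smul_neg, sub_neg_eq_add, ← two_smul ℂ, smul_smul, mul_comm, inv_sqrt_two_mul_two]

/-- **The Hubbard Hamiltonian on `(ℤ/Lℤ)²`, `L ≥ 3`, indexed by torus sites**:
`H = -t Σ_x Σ_{e ∈ {±e₁,±e₂}} Σ_σ c†_{xσ} c_{x+e,σ} + U Σ_x n_{x↑} n_{x↓}` (each site has exactly the
four neighbours `x + e`). Lieb, PRL 62 (1989) 1201; Friedli–Velenik (2017) §3.1. [folklore] -/
theorem hubbardTorus_eq_sum_unitSteps (hL : 2 < L) (t U : ℝ) :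
    hubbardTorus 2 L t U =
      -(t : ℂ) • (∑ x : TorusSite 2 L, ∑ e ∈ unitSteps, ∑ σ : Fin 2,
          creation (orb (FermionTorus.ofTorusSite x) σ) *
            annihilation (orb (FermionTorus.ofTorusSite (x + Torus.proj L e)) σ)) +
      (U : ℂ) • ∑ x : TorusSite 2 L,
          numberOp (FermionTorus.ofTorusSite x) 0 * numberOp (FermionTorus.ofTorusSite x) 1 := by
  unfold hubbardTorus hamiltonian
  have hsymm : ∀ (G : FermionTorus 2 L → Matrix (Finset (Orb (FermionTorus 2 L)))
      (Finset (Orb (FermionTorus 2 L))) ℂ),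
      ∑ y : FermionTorus 2 L, G y = ∑ x : TorusSite 2 L, G (FermionTorus.ofTorusSite x) := by
    intro G
    exact ((FermionTorus.equivTorusSite (d := 2) (L := L)).symm.sum_comp G).symm
  congr 2
  · rw [hsymm]
    refine Finset.sum_congr rfl fun x _ => ?_
    rw [Finset.sum_comm]
    conv_rhs => rw [Finset.sum_comm]
    refine Finset.sum_congr rfl fun σ _ => ?_
    rw [sum_ite_fermionAdj_eq_sum_unitSteps hL]
    simp only [FermionTorus.toTorusSite_ofTorusSite]
  · rw [hsymm]

end NormalForms

end Summit.HubbardSuperconductivity.EnslavedA1g
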